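import Summits.QuantumFields.BalabanUV.T4Continuum.Support.NE3CovariantWeitzenbock

/-!
# NE7CovariantWeitzenbockTwoForm — THE COVARIANT LATTICE WEITZENBÖCK INEQUALITY FOR 2-FORMS (plaquette functions) at a unitary
# periodic small-field background, HS currency: `3·(gradient energy) = (exterior-derivative energy) + 6·(divergence energy)`
# up to a curvature-commutator remainder `≤ 12·d·a·‖B‖²` — step (E1) of the energy road (h7), general form

Cell `pub-balaban`, rung (B)+1 sub-cell t4, lineage `b2b-balaban-t4-ne7-p1`, generation 62 (CRUX PROVER NE7 #1, ruling e34b3e0c (2)); hunt (h7)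
«ENERGY ROAD to the (A)-bill at data with curvature» (`t4/b2b-balaban-t4-ne7-p1-g61/HUNT-H7-ENERGY-ROAD.md`), step (E1).  The 1-form case is the
NE3 swarm's `NE3CovariantWeitzenbock.covariant_weitzenbock` (`|G − C − Div| ≤ 2·d·a·‖A‖²`); THIS file is the 2-form case NE7 needs (the flux
`F = log U(∂p)` is a 2-form): for an ANTISYMMETRIC site-framed 2-form `B(x; μ, ν) = −B(x; ν, μ)` on the period box of a unitary `P`-periodic
`V` with `‖V(∂p) − 1‖ ≤ a`,

  `|3·G₂ − C₂ − 6·Div₂| ≤ 12·d·a·Σ_x Σ_μ Σ_ν ‖B(x; μ, ν)‖²`,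

with (all sums over ALL ordered index tuples; `∇_κ = NE3CovariantCalculus.cD V κ`, `∇_κ^† = cDstar V κ`)
`G₂ = Σ_x Σ_κ Σ_μ Σ_ν nhsNormSq (∇_κ B_{μν})` (gradient energy), `C₂ = Σ_x Σ_κ Σ_μ Σ_ν nhsNormSq (∇_κ B_{μν} + ∇_μ B_{νκ} + ∇_ν B_{κμ})` (the energy of
the covariant exterior derivative, each unordered triple counted `3! = 6` times) and `Div₂ = Σ_x Σ_ν nhsNormSq (Σ_μ ∇_μ^† B_{μν})` (the energy of the
covariant codifferential = the Yang–Mills TENSION when `B` is the flux).  At a flat background (`a = 0`) this is the exact lattice Hodge identity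
`‖∇B‖² = ‖dB‖² + ‖δB‖²` for periodic 2-cochains (with `G₂ = 2·Σ_κ Σ_{μ<ν}`, `C₂ = 6·Σ_{κ<μ<ν}`).

WHAT ([folklore] discrete covariant calculus at ONE unitary configuration; 0 def; 0 sorry):
§1 pointwise algebra: `cD_neg`, `cDstar_neg`, `hsR_neg_self`, `nhsNormSq_add_three`, the cyclic relabelings `sum_cyc₃`, `sum_cyc₃'`,
   and **`sum_nhsNormSq_cyclic_expand`**: `Σ_{κμν} nhsNormSq (X_{κμν} + X_{μνκ} + X_{νκμ}) = 3·Σ nhsNormSq X_{κμν} + 6·Σ hsR X_{κμν} X_{μνκ}` (any `X`);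
§2 the cross term: **`cross_eq`** — `Σ_x hsR (∇_κ B_{μν}) (∇_μ B_{νκ}) = Σ_x hsR (∇_κ^† B_{νκ}) (∇_μ^† B_{μν}) + Σ_x hsR (B_{μν}) ([∇_κ^†, ∇_μ] B_{νκ})` (two
   periodic covariant summations by parts, `NE3CovariantCalculus.sum_hsR_cD`), **`abs_comm_term_le`** (the commutator term is
   `≤ a·(Σ_x‖B_{μν}‖² + Σ_x‖B_{νκ}‖²)`, `NE3CovariantCalculus.norm_comm_le`), **`sum_cross_adj_eq_neg_div`** (antisymmetry: the adjoint term summed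
   over `κ, μ` is MINUS the divergence energy);
§3 **`covariant_weitzenbock_twoForm`** (displayed above) and the one-sided consumer form **`grad_le_ext_add_div`**:
   `G₂ ≤ C₂∕3 + 2·Div₂ + 4·d·a·‖B‖²`.
HONEST FRAMING (page 1): FIXED FINITE torus, rung (B)+1; elementary lattice algebra at one configuration — nothing about minimisers; it is the
general form of (E1) (the flux instance, with the Bianchi bound `NE7LatticeBianchi.covariant_bianchi_le` killing `C₂`, is the companion file
`NE7FluxGradientFromTension`); (E2), (E3) and the interiority (8) of the hunt memo remain; NE7, NE3 NOT PRINTED in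
[Balaban1984PropagatorsI]–[Balaban1989LargeFieldII] and NOT PROVED; continuum YM on T⁴ ⇐ BetaPertH ∧ nine spine estimates (0/9 proved);
BetaPertH ⇐ (D1) ∧ (D4) ∧ CAP+tail; G-an2-4 gates asym, D1 and NE2/3/4; NOT infinite volume, NOT mass gap, NOT Clay.
-/

set_option autoImplicit false

open scoped BigOperators Matrix Matrix.Norms.L2Operator
open NormedSpace Finset

namespace Summit.QuantumFields.BalabanUV.T4Continuum.NE7CovariantWeitzenbockTwoForm

open Literature.MathematicalPhysics.QuantumFieldTheory.Balaban1983to89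
open B7Prop1Explicit B7Prop2Explicit MatrixLog UnitaryModel MatrixNorms
open T4AveragingDeficitWall hiding Site Plane Plaq Bond
open T4AveragingDeficitWallBoundary (periodBox sum_periodBox_shift IsPeriodicCfg)
open T4AveragingDeficitNonAbelian (Ad_mul Ad_sub)
open AveragingDeficitTransport (norm_Ad_of_unitary mem_U1_of_unitary val_inv_eq_star_of_unitary)
open AveragingDeficitNearIdentity (Ad_one norm_Ad_sub_le nReTr_Ad Ad_mul_Ad abs_nReTr_mul_le Ad_neg)
open NE3CovariantCalculus
open NE3CovariantWeitzenbock (plaq_bound_of_smallField)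

noncomputable section

variable {d : ℕ} {n : Type*} [Fintype n] [DecidableEq n]

/-! ## §1 Pointwise algebra -/

/-- `∇_μ(−f) = −∇_μ f`. [folklore] -/
theorem cD_neg (V : Site d → Fin d → (Matrix n n ℂ)ˣ) (μ : Fin d) (f : Site d → Matrix n n ℂ) (x : Site d) :
    cD V μ (fun y => -f y) x = -cD V μ f x := by
  show Ad (V x μ) (-f (x + e μ)) - -f x = -(Ad (V x μ) (f (x + e μ)) - f x)
  rw [Ad_neg, neg_sub_neg, neg_sub]

/-- `∇_μ^†(−g) = −∇_μ^† g`. [folklore] -/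
theorem cDstar_neg (V : Site d → Fin d → (Matrix n n ℂ)ˣ) (μ : Fin d) (g : Site d → Matrix n n ℂ) (x : Site d) :
    cDstar V μ (fun y => -g y) x = -cDstar V μ g x := by
  show Ad (V (x - e μ) μ)⁻¹ (-g (x - e μ)) - -g x = -(Ad (V (x - e μ) μ)⁻¹ (g (x - e μ)) - g x)
  rw [Ad_neg, neg_sub_neg, neg_sub]

omit [DecidableEq n] in
/-- `hsR (−X) X = −nhsNormSq X` (the tree's `hsR_neg_left` of `NE3FrameFreeDecompositionPrep`, specialised; kept local to spare that import).
[folklore] -/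
theorem hsR_neg_self (X : Matrix n n ℂ) : hsR (-X) X = -nhsNormSq X := by
  have h := hsR_sub_left 0 X X
  have h0 : hsR (0 : Matrix n n ℂ) X = 0 := by simp [hsR, nReTr]
  rw [zero_sub, h0, zero_sub, hsR_self] at h
  exact h

/-- The three-term expansion `nhsNormSq (X + Y + Z) = Σ squares + 2·Σ cross forms`. [folklore] -/
theorem nhsNormSq_add_three (X Y Z : Matrix n n ℂ) :
    nhsNormSq (X + Y + Z) = nhsNormSq X + nhsNormSq Y + nhsNormSq Z + 2 * hsR X Y + 2 * hsR X Z + 2 * hsR Y Z := by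
  rw [← hsR_self, ← hsR_self X, ← hsR_self Y, ← hsR_self Z]
  simp only [hsR_add_left, hsR_add_right]
  rw [hsR_comm Y X, hsR_comm Z X, hsR_comm Z Y]
  ring

/-- Cyclic relabeling of a triple index sum: `Σ_{κμν} f(μ,ν,κ) = Σ_{κμν} f(κ,μ,ν)`. [folklore] -/
theorem sum_cyc₃ (f : Fin d → Fin d → Fin d → ℝ) :
    ∑ κ : Fin d, ∑ μ : Fin d, ∑ ν : Fin d, f μ ν κ = ∑ κ : Fin d, ∑ μ : Fin d, ∑ ν : Fin d, f κ μ ν := by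
  have h1 : ∑ κ : Fin d, ∑ μ : Fin d, ∑ ν : Fin d, f μ ν κ = ∑ μ : Fin d, ∑ κ : Fin d, ∑ ν : Fin d, f μ ν κ := Finset.sum_comm
  rw [h1]
  exact Finset.sum_congr rfl fun μ _ => Finset.sum_comm

/-- The inverse cyclic relabeling: `Σ_{κμν} f(ν,κ,μ) = Σ_{κμν} f(κ,μ,ν)`. [folklore] -/
theorem sum_cyc₃' (f : Fin d → Fin d → Fin d → ℝ) :
    ∑ κ : Fin d, ∑ μ : Fin d, ∑ ν : Fin d, f ν κ μ = ∑ κ : Fin d, ∑ μ : Fin d, ∑ ν : Fin d, f κ μ ν := by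
  exact (sum_cyc₃ (fun a b c => f c a b)).symm

/-- **THE SQUARE OF THE CYCLIC SUM, EXPANDED** (any triple-indexed family): 
`Σ_{κμν} nhsNormSq (X_{κμν} + X_{μνκ} + X_{νκμ}) = 3·Σ_{κμν} nhsNormSq X_{κμν} + 6·Σ_{κμν} hsR X_{κμν} X_{μνκ}`. [folklore] -/
theorem sum_nhsNormSq_cyclic_expand (X : Fin d → Fin d → Fin d → Matrix n n ℂ) :
    ∑ κ : Fin d, ∑ μ : Fin d, ∑ ν : Fin d, nhsNormSq (X κ μ ν + X μ ν κ + X ν κ μ)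
      = 3 * ∑ κ : Fin d, ∑ μ : Fin d, ∑ ν : Fin d, nhsNormSq (X κ μ ν)
        + 6 * ∑ κ : Fin d, ∑ μ : Fin d, ∑ ν : Fin d, hsR (X κ μ ν) (X μ ν κ) := by
  have e1 : ∑ κ : Fin d, ∑ μ : Fin d, ∑ ν : Fin d, nhsNormSq (X μ ν κ) = ∑ κ : Fin d, ∑ μ : Fin d, ∑ ν : Fin d, nhsNormSq (X κ μ ν) :=
    sum_cyc₃ (fun a b c => nhsNormSq (X a b c))
  have e2 : ∑ κ : Fin d, ∑ μ : Fin d, ∑ ν : Fin d, nhsNormSq (X ν κ μ) = ∑ κ : Fin d, ∑ μ : Fin d, ∑ ν : Fin d, nhsNormSq (X κ μ ν) :=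
    sum_cyc₃' (fun a b c => nhsNormSq (X a b c))
  have e3 : ∑ κ : Fin d, ∑ μ : Fin d, ∑ ν : Fin d, hsR (X μ ν κ) (X ν κ μ)
      = ∑ κ : Fin d, ∑ μ : Fin d, ∑ ν : Fin d, hsR (X κ μ ν) (X μ ν κ) :=
    sum_cyc₃ (fun a b c => hsR (X a b c) (X b c a))
  have e4 : ∑ κ : Fin d, ∑ μ : Fin d, ∑ ν : Fin d, hsR (X κ μ ν) (X ν κ μ)
      = ∑ κ : Fin d, ∑ μ : Fin d, ∑ ν : Fin d, hsR (X κ μ ν) (X μ ν κ) := by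
    rw [← sum_cyc₃' (fun a b c => hsR (X a b c) (X b c a))]
    exact Finset.sum_congr rfl fun κ _ => Finset.sum_congr rfl fun μ _ => Finset.sum_congr rfl fun ν _ => hsR_comm _ _
  simp only [nhsNormSq_add_three, Finset.sum_add_distrib, ← Finset.mul_sum]
  rw [e1, e2, e3, e4]
  ring

/-! ## §2 The cross term: two covariant summations by parts and the commutator -/

section Periodic

variable {P : ℕ} {V : Site d → Fin d → (Matrix n n ℂ)ˣ} {B : Site d → Fin d → Fin d → Matrix n n ℂ}

omit [Fintype n] [DecidableEq n] in
/-- Components of a periodic 2-form are periodic site functions. [folklore] -/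
theorem comp_periodic (hB : ∀ (x : Site d) (κ μ ν : Fin d), B (x + (P : ℤ) • e κ) μ ν = B x μ ν) (μ ν : Fin d) :
    ∀ (x : Site d) (κ : Fin d), (fun y => B y μ ν) (x + (P : ℤ) • e κ) = (fun y => B y μ ν) x :=
  fun x κ => hB x κ μ ν

/-- Per-component period sums of a periodic 2-form are shift invariant. [folklore] -/
theorem sum_shift_sq₂ (hP : 1 ≤ P) (hB : ∀ (x : Site d) (κ μ ν : Fin d), B (x + (P : ℤ) • e κ) μ ν = B x μ ν)
    (v : Site d) (μ ν : Fin d) :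
    ∑ x ∈ periodBox (d := d) P, ‖B (x + v) μ ν‖ ^ 2 = ∑ x ∈ periodBox (d := d) P, ‖B x μ ν‖ ^ 2 :=
  sum_periodBox_shift (d := d) P hP (g := fun x => ‖B x μ ν‖ ^ 2) (fun x κ => by simp only [hB x κ μ ν]) v

/-- **THE CROSS TERM** for one index triple: two periodic covariant summations by parts move `∇_κ` and `∇_μ` across, at the price of the
commutator `[∇_κ^†, ∇_μ]`:
`Σ_x hsR (∇_κ B_{μν}) (∇_μ B_{νκ}) = Σ_x hsR (∇_κ^† B_{νκ}) (∇_μ^† B_{μν}) + Σ_x hsR B_{μν} (∇_κ^†∇_μ B_{νκ} − ∇_μ∇_κ^† B_{νκ})`. [folklore] -/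
theorem cross_eq (hP : 1 ≤ P) (hV : IsUnitaryCfg V) (hVP : IsPeriodicCfg V (P : ℤ))
    (hB : ∀ (x : Site d) (κ μ ν : Fin d), B (x + (P : ℤ) • e κ) μ ν = B x μ ν) (κ μ ν : Fin d) :
    ∑ x ∈ periodBox (d := d) P, hsR (cD V κ (fun y => B y μ ν) x) (cD V μ (fun y => B y ν κ) x)
      = ∑ x ∈ periodBox (d := d) P, hsR (cDstar V κ (fun y => B y ν κ) x) (cDstar V μ (fun y => B y μ ν) x)
        + ∑ x ∈ periodBox (d := d) P, hsR (B x μ ν)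
            (cDstar V κ (cD V μ (fun y => B y ν κ)) x - cD V μ (cDstar V κ (fun y => B y ν κ)) x) := by
  -- first summation by parts: `∇_κ` across
  have h1 : ∑ x ∈ periodBox (d := d) P, hsR (cD V κ (fun y => B y μ ν) x) (cD V μ (fun y => B y ν κ) x)
      = ∑ x ∈ periodBox (d := d) P, hsR (B x μ ν) (cDstar V κ (cD V μ (fun y => B y ν κ)) x) :=
    sum_hsR_cD hP hV hVP κ (comp_periodic hB μ ν) (cD_periodic hVP μ (f := fun y => B y ν κ) (comp_periodic hB ν κ))
  -- second summation by parts: `∇_μ` across (read backwards)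
  have h2 : ∑ x ∈ periodBox (d := d) P, hsR (B x μ ν) (cD V μ (cDstar V κ (fun y => B y ν κ)) x)
      = ∑ x ∈ periodBox (d := d) P, hsR (cDstar V κ (fun y => B y ν κ) x) (cDstar V μ (fun y => B y μ ν) x) := by
    have h' := sum_hsR_cD hP hV hVP μ (f := cDstar V κ (fun y => B y ν κ)) (g := fun y => B y μ ν)
      (cDstar_periodic hVP κ (g := fun y => B y ν κ) (comp_periodic hB ν κ)) (comp_periodic hB μ ν)
    rw [← h']
    exact Finset.sum_congr rfl fun x _ => hsR_comm _ _
  rw [h1, ← h2, ← Finset.sum_add_distrib]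
  exact Finset.sum_congr rfl fun x _ => by rw [hsR_sub_right]; ring

/-- **THE COMMUTATOR TERM IS `O(a)`**: `|Σ_x hsR B_{μν} ([∇_κ^†, ∇_μ] B_{νκ})| ≤ a·(Σ_x ‖B_{μν}‖² + Σ_x ‖B_{νκ}‖²)` when every plaquette variable is
within `a` of `1` (`NE3CovariantCalculus.norm_comm_le` after the shift `x = z + e_κ`, Cauchy–Schwarz in operator norms, `2pq ≤ p² + q²`). [folklore] -/
theorem abs_comm_term_le [Nonempty n] {a : ℝ} (hP : 1 ≤ P) (hV : IsUnitaryCfg V) (hVP : IsPeriodicCfg V (P : ℤ))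
    (hplaq : ∀ (z : Site d) (μ ν : Fin d), ‖((hol V z (plaqWord μ ν) : (Matrix n n ℂ)ˣ) : (Matrix n n ℂ)) - 1‖ ≤ a)
    (hB : ∀ (x : Site d) (κ μ ν : Fin d), B (x + (P : ℤ) • e κ) μ ν = B x μ ν) (κ μ ν : Fin d) :
    |∑ x ∈ periodBox (d := d) P, hsR (B x μ ν)
        (cDstar V κ (cD V μ (fun y => B y ν κ)) x - cD V μ (cDstar V κ (fun y => B y ν κ)) x)|
      ≤ a * (∑ x ∈ periodBox (d := d) P, ‖B x μ ν‖ ^ 2 + ∑ x ∈ periodBox (d := d) P, ‖B x ν κ‖ ^ 2) := by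
  set T : Site d → ℝ := fun x => hsR (B x μ ν)
      (cDstar V κ (cD V μ (fun y => B y ν κ)) x - cD V μ (cDstar V κ (fun y => B y ν κ)) x) with hT
  have hTper : ∀ (x : Site d) (ι : Fin d), T (x + (P : ℤ) • e ι) = T x := by
    intro x ι
    simp only [hT]
    rw [hB x ι μ ν, cDstar_periodic hVP κ (g := cD V μ (fun y => B y ν κ)) (cD_periodic hVP μ (f := fun y => B y ν κ) (comp_periodic hB ν κ)),
      cD_periodic hVP μ (f := cDstar V κ (fun y => B y ν κ)) (cDstar_periodic hVP κ (g := fun y => B y ν κ) (comp_periodic hB ν κ))]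
  have hre := sum_periodBox_shift (d := d) P hP hTper (e κ)
  rw [← hre]
  refine (Finset.abs_sum_le_sum_abs _ _).trans ?_
  have hz : ∀ z ∈ periodBox (d := d) P, |T (z + e κ)| ≤ a * (‖B (z + e κ) μ ν‖ ^ 2 + ‖B (z + e μ) ν κ‖ ^ 2) := by
    intro z _
    simp only [hT]
    refine (abs_hsR_le _ _).trans ?_
    have hc := norm_comm_le hV κ μ (fun y => B y ν κ) z (hplaq z κ μ)
    have h0 : 0 ≤ ‖B (z + e κ) μ ν‖ := norm_nonneg _
    have h1 : 0 ≤ ‖B (z + e μ) ν κ‖ := norm_nonneg _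
    have ha0 : 0 ≤ a := (norm_nonneg _).trans (hplaq z κ μ)
    calc ‖B (z + e κ) μ ν‖ * ‖cDstar V κ (cD V μ (fun y => B y ν κ)) (z + e κ) - cD V μ (cDstar V κ (fun y => B y ν κ)) (z + e κ)‖
        ≤ ‖B (z + e κ) μ ν‖ * (2 * a * ‖B (z + e μ) ν κ‖) := mul_le_mul_of_nonneg_left hc h0
      _ ≤ a * (‖B (z + e κ) μ ν‖ ^ 2 + ‖B (z + e μ) ν κ‖ ^ 2) := by
          nlinarith [sq_nonneg (‖B (z + e κ) μ ν‖ - ‖B (z + e μ) ν κ‖)]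
  refine (Finset.sum_le_sum hz).trans (le_of_eq ?_)
  rw [← Finset.mul_sum, Finset.sum_add_distrib, sum_shift_sq₂ hP hB (e κ) μ ν, sum_shift_sq₂ hP hB (e μ) ν κ]

/-- **ANTISYMMETRY TURNS THE ADJOINT TERM INTO MINUS THE DIVERGENCE ENERGY**: for `B_{νκ} = −B_{κν}`,
`Σ_κ Σ_μ Σ_ν Σ_x hsR (∇_κ^† B_{νκ}) (∇_μ^† B_{μν}) = −Σ_x Σ_ν nhsNormSq (Σ_μ ∇_μ^† B_{μν})`. [folklore] -/
theorem sum_cross_adj_eq_neg_div (S : Finset (Site d)) (V : Site d → Fin d → (Matrix n n ℂ)ˣ)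
    (B : Site d → Fin d → Fin d → Matrix n n ℂ) (hanti : ∀ (x : Site d) (μ ν : Fin d), B x ν μ = -B x μ ν) :
    ∑ κ : Fin d, ∑ μ : Fin d, ∑ ν : Fin d, ∑ x ∈ S, hsR (cDstar V κ (fun y => B y ν κ) x) (cDstar V μ (fun y => B y μ ν) x)
      = -∑ x ∈ S, ∑ ν : Fin d, nhsNormSq (∑ μ : Fin d, cDstar V μ (fun y => B y μ ν) x) := by
  -- `∇_κ^† B_{νκ} = −∇_κ^† B_{κν}`
  have hneg : ∀ (κ ν : Fin d) (x : Site d), cDstar V κ (fun y => B y ν κ) x = -cDstar V κ (fun y => B y κ ν) x := by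
    intro κ ν x
    rw [← cDstar_neg]
    exact congrArg (fun f => cDstar V κ f x) (funext fun y => hanti y κ ν)
  -- reorder the sums to `Σ_x Σ_ν Σ_κ Σ_μ`
  have hord : ∑ κ : Fin d, ∑ μ : Fin d, ∑ ν : Fin d, ∑ x ∈ S, hsR (cDstar V κ (fun y => B y ν κ) x) (cDstar V μ (fun y => B y μ ν) x)
      = ∑ x ∈ S, ∑ ν : Fin d, ∑ κ : Fin d, ∑ μ : Fin d, hsR (cDstar V κ (fun y => B y ν κ) x) (cDstar V μ (fun y => B y μ ν) x) := by
    calc ∑ κ : Fin d, ∑ μ : Fin d, ∑ ν : Fin d, ∑ x ∈ S, hsR (cDstar V κ (fun y => B y ν κ) x) (cDstar V μ (fun y => B y μ ν) x)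
        = ∑ κ : Fin d, ∑ μ : Fin d, ∑ x ∈ S, ∑ ν : Fin d, hsR (cDstar V κ (fun y => B y ν κ) x) (cDstar V μ (fun y => B y μ ν) x) :=
          Finset.sum_congr rfl fun κ _ => Finset.sum_congr rfl fun μ _ => Finset.sum_comm
      _ = ∑ κ : Fin d, ∑ x ∈ S, ∑ μ : Fin d, ∑ ν : Fin d, hsR (cDstar V κ (fun y => B y ν κ) x) (cDstar V μ (fun y => B y μ ν) x) :=
          Finset.sum_congr rfl fun κ _ => Finset.sum_comm
      _ = ∑ x ∈ S, ∑ κ : Fin d, ∑ μ : Fin d, ∑ ν : Fin d, hsR (cDstar V κ (fun y => B y ν κ) x) (cDstar V μ (fun y => B y μ ν) x) :=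
          Finset.sum_comm
      _ = ∑ x ∈ S, ∑ ν : Fin d, ∑ κ : Fin d, ∑ μ : Fin d, hsR (cDstar V κ (fun y => B y ν κ) x) (cDstar V μ (fun y => B y μ ν) x) := by
          refine Finset.sum_congr rfl fun x _ => ?_
          rw [← sum_cyc₃' (fun ν κ μ => hsR (cDstar V κ (fun y => B y ν κ) x) (cDstar V μ (fun y => B y μ ν) x))]
  rw [hord, ← Finset.sum_neg_distrib]
  refine Finset.sum_congr rfl fun x _ => ?_
  rw [← Finset.sum_neg_distrib]
  refine Finset.sum_congr rfl fun ν _ => ?_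
  -- `Σ_κ Σ_μ hsR (P κ) (Q μ) = hsR (Σ P) (Σ Q)` and `Σ_κ P κ = −Σ_μ Q μ`
  have hP : ∑ κ : Fin d, cDstar V κ (fun y => B y ν κ) x = -∑ μ : Fin d, cDstar V μ (fun y => B y μ ν) x := by
    rw [← Finset.sum_neg_distrib]
    exact Finset.sum_congr rfl fun κ _ => hneg κ ν x
  calc ∑ κ : Fin d, ∑ μ : Fin d, hsR (cDstar V κ (fun y => B y ν κ) x) (cDstar V μ (fun y => B y μ ν) x)
      = hsR (∑ κ : Fin d, cDstar V κ (fun y => B y ν κ) x) (∑ μ : Fin d, cDstar V μ (fun y => B y μ ν) x) := by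
        rw [hsR_sum_left]
        exact Finset.sum_congr rfl fun κ _ => (hsR_sum_right _ _ _).symm
    _ = -nhsNormSq (∑ μ : Fin d, cDstar V μ (fun y => B y μ ν) x) := by
        rw [hP, hsR_neg_self]

/-! ## §3 The covariant Weitzenböck inequality for antisymmetric 2-forms -/

/-- **THE COVARIANT LATTICE WEITZENBÖCK INEQUALITY FOR 2-FORMS.**  For `P ≥ 1`, a unitary `P`-periodic `V` with `‖V(∂p) − 1‖ ≤ a` at every
plaquette word, and a `P`-periodic ANTISYMMETRIC site-framed 2-form `B`:

  `|3·G₂ − C₂ − 6·Div₂| ≤ 12·d·a·Σ_x Σ_μ Σ_ν ‖B(x; μ, ν)‖²`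

with `G₂ = Σ_x Σ_κ Σ_μ Σ_ν nhsNormSq (∇_κ B_{μν})`, `C₂ = Σ_x Σ_κ Σ_μ Σ_ν nhsNormSq (∇_κ B_{μν} + ∇_μ B_{νκ} + ∇_ν B_{κμ})`,
`Div₂ = Σ_x Σ_ν nhsNormSq (Σ_μ ∇_μ^† B_{μν})` (sums over the period box and ALL index tuples; `∇ = cD V`, `∇^† = cDstar V`).  At a flat background the
right-hand side vanishes: the lattice Hodge identity for periodic 2-cochains. [folklore] -/
theorem covariant_weitzenbock_twoForm [Nonempty n] {a : ℝ} (hP : 1 ≤ P) (hV : IsUnitaryCfg V) (hVP : IsPeriodicCfg V (P : ℤ))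
    (hplaq : ∀ (z : Site d) (μ ν : Fin d), ‖((hol V z (plaqWord μ ν) : (Matrix n n ℂ)ˣ) : (Matrix n n ℂ)) - 1‖ ≤ a)
    (hB : ∀ (x : Site d) (κ μ ν : Fin d), B (x + (P : ℤ) • e κ) μ ν = B x μ ν)
    (hanti : ∀ (x : Site d) (μ ν : Fin d), B x ν μ = -B x μ ν) :
    |3 * (∑ x ∈ periodBox (d := d) P, ∑ κ : Fin d, ∑ μ : Fin d, ∑ ν : Fin d, nhsNormSq (cD V κ (fun y => B y μ ν) x))
      - (∑ x ∈ periodBox (d := d) P, ∑ κ : Fin d, ∑ μ : Fin d, ∑ ν : Fin d,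
          nhsNormSq (cD V κ (fun y => B y μ ν) x + cD V μ (fun y => B y ν κ) x + cD V ν (fun y => B y κ μ) x))
      - 6 * (∑ x ∈ periodBox (d := d) P, ∑ ν : Fin d, nhsNormSq (∑ μ : Fin d, cDstar V μ (fun y => B y μ ν) x))|
      ≤ 12 * d * a * ∑ x ∈ periodBox (d := d) P, ∑ μ : Fin d, ∑ ν : Fin d, ‖B x μ ν‖ ^ 2 := by
  -- names for the commutator term of a triple and the per-component norms
  obtain ⟨R, hR⟩ : ∃ R : Fin d → Fin d → Fin d → ℝ, ∀ κ μ ν, R κ μ ν = ∑ x ∈ periodBox (d := d) P, hsR (B x μ ν)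
      (cDstar V κ (cD V μ (fun y => B y ν κ)) x - cD V μ (cDstar V κ (fun y => B y ν κ)) x) := ⟨_, fun _ _ _ => rfl⟩
  obtain ⟨S, hS⟩ : ∃ S : Fin d → Fin d → ℝ, ∀ μ ν, S μ ν = ∑ x ∈ periodBox (d := d) P, ‖B x μ ν‖ ^ 2 := ⟨_, fun _ _ => rfl⟩
  -- Step A: the pointwise expansion of `C₂`, summed over the period
  have hA : (∑ x ∈ periodBox (d := d) P, ∑ κ : Fin d, ∑ μ : Fin d, ∑ ν : Fin d,
          nhsNormSq (cD V κ (fun y => B y μ ν) x + cD V μ (fun y => B y ν κ) x + cD V ν (fun y => B y κ μ) x))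
      = 3 * (∑ x ∈ periodBox (d := d) P, ∑ κ : Fin d, ∑ μ : Fin d, ∑ ν : Fin d, nhsNormSq (cD V κ (fun y => B y μ ν) x))
        + 6 * ∑ x ∈ periodBox (d := d) P, ∑ κ : Fin d, ∑ μ : Fin d, ∑ ν : Fin d,
            hsR (cD V κ (fun y => B y μ ν) x) (cD V μ (fun y => B y ν κ) x) := by
    rw [Finset.mul_sum, Finset.mul_sum, ← Finset.sum_add_distrib]
    exact Finset.sum_congr rfl fun x _ => sum_nhsNormSq_cyclic_expand (fun κ μ ν => cD V κ (fun y => B y μ ν) x)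
  -- Step B: the cross term, triple by triple
  have hX : ∑ x ∈ periodBox (d := d) P, ∑ κ : Fin d, ∑ μ : Fin d, ∑ ν : Fin d,
        hsR (cD V κ (fun y => B y μ ν) x) (cD V μ (fun y => B y ν κ) x)
      = ∑ κ : Fin d, ∑ μ : Fin d, ∑ ν : Fin d,
          (∑ x ∈ periodBox (d := d) P, hsR (cDstar V κ (fun y => B y ν κ) x) (cDstar V μ (fun y => B y μ ν) x) + R κ μ ν) := by
    calc ∑ x ∈ periodBox (d := d) P, ∑ κ : Fin d, ∑ μ : Fin d, ∑ ν : Fin d,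
          hsR (cD V κ (fun y => B y μ ν) x) (cD V μ (fun y => B y ν κ) x)
        = ∑ κ : Fin d, ∑ x ∈ periodBox (d := d) P, ∑ μ : Fin d, ∑ ν : Fin d,
            hsR (cD V κ (fun y => B y μ ν) x) (cD V μ (fun y => B y ν κ) x) := Finset.sum_comm
      _ = ∑ κ : Fin d, ∑ μ : Fin d, ∑ x ∈ periodBox (d := d) P, ∑ ν : Fin d,
            hsR (cD V κ (fun y => B y μ ν) x) (cD V μ (fun y => B y ν κ) x) := Finset.sum_congr rfl fun κ _ => Finset.sum_comm
      _ = ∑ κ : Fin d, ∑ μ : Fin d, ∑ ν : Fin d, ∑ x ∈ periodBox (d := d) P,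
            hsR (cD V κ (fun y => B y μ ν) x) (cD V μ (fun y => B y ν κ) x) :=
          Finset.sum_congr rfl fun κ _ => Finset.sum_congr rfl fun μ _ => Finset.sum_comm
      _ = _ := Finset.sum_congr rfl fun κ _ => Finset.sum_congr rfl fun μ _ => Finset.sum_congr rfl fun ν _ => by
          rw [cross_eq hP hV hVP hB κ μ ν, hR]
  -- Step C: the adjoint term is minus the divergence energy
  have hY := sum_cross_adj_eq_neg_div (periodBox (d := d) P) V B hanti
  -- Step D: the commutator terms
  have hRle : ∀ κ μ ν : Fin d, |R κ μ ν| ≤ a * (S μ ν + S ν κ) := fun κ μ ν => by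
    rw [hR, hS, hS]; exact abs_comm_term_le hP hV hVP hplaq hB κ μ ν
  -- the left-hand side is `|−6·Σ R|`
  have key : 3 * (∑ x ∈ periodBox (d := d) P, ∑ κ : Fin d, ∑ μ : Fin d, ∑ ν : Fin d, nhsNormSq (cD V κ (fun y => B y μ ν) x))
      - (∑ x ∈ periodBox (d := d) P, ∑ κ : Fin d, ∑ μ : Fin d, ∑ ν : Fin d,
          nhsNormSq (cD V κ (fun y => B y μ ν) x + cD V μ (fun y => B y ν κ) x + cD V ν (fun y => B y κ μ) x))
      - 6 * (∑ x ∈ periodBox (d := d) P, ∑ ν : Fin d, nhsNormSq (∑ μ : Fin d, cDstar V μ (fun y => B y μ ν) x))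
      = -6 * ∑ κ : Fin d, ∑ μ : Fin d, ∑ ν : Fin d, R κ μ ν := by
    rw [hA, hX]
    simp only [Finset.sum_add_distrib]
    rw [hY]
    ring
  rw [key]
  -- counting: `Σ_{κμν} a·(S_{μν} + S_{νκ}) = 2·d·a·Σ_{μν} S_{μν}`
  have hNB : ∑ x ∈ periodBox (d := d) P, ∑ μ : Fin d, ∑ ν : Fin d, ‖B x μ ν‖ ^ 2 = ∑ μ : Fin d, ∑ ν : Fin d, S μ ν := by
    rw [Finset.sum_comm]
    refine Finset.sum_congr rfl fun μ _ => ?_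
    rw [Finset.sum_comm]
    exact Finset.sum_congr rfl fun ν _ => (hS μ ν).symm
  have hcount : ∑ κ : Fin d, ∑ μ : Fin d, ∑ ν : Fin d, a * (S μ ν + S ν κ) = 2 * d * a * ∑ μ : Fin d, ∑ ν : Fin d, S μ ν := by
    have e1 : ∑ κ : Fin d, ∑ μ : Fin d, ∑ ν : Fin d, S μ ν = d * ∑ μ : Fin d, ∑ ν : Fin d, S μ ν := by
      rw [Finset.sum_const, Finset.card_univ, Fintype.card_fin, nsmul_eq_mul]
    have e2 : ∑ κ : Fin d, ∑ μ : Fin d, ∑ ν : Fin d, S ν κ = d * ∑ μ : Fin d, ∑ ν : Fin d, S μ ν := by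
      rw [sum_cyc₃' (fun a b _ => S a b)]
      rw [Finset.mul_sum]
      refine Finset.sum_congr rfl fun κ _ => ?_
      rw [Finset.mul_sum]
      refine Finset.sum_congr rfl fun μ _ => ?_
      rw [Finset.sum_const, Finset.card_univ, Fintype.card_fin, nsmul_eq_mul]
    simp only [mul_add, Finset.sum_add_distrib, ← Finset.mul_sum]
    rw [e1, e2]
    ring
  calc |-6 * ∑ κ : Fin d, ∑ μ : Fin d, ∑ ν : Fin d, R κ μ ν|
      = 6 * |∑ κ : Fin d, ∑ μ : Fin d, ∑ ν : Fin d, R κ μ ν| := by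
        rw [abs_mul, abs_neg, abs_of_nonneg (by norm_num : (0 : ℝ) ≤ 6)]
    _ ≤ 6 * ∑ κ : Fin d, ∑ μ : Fin d, ∑ ν : Fin d, |R κ μ ν| := by
        refine mul_le_mul_of_nonneg_left ?_ (by norm_num)
        refine (Finset.abs_sum_le_sum_abs _ _).trans (Finset.sum_le_sum fun κ _ => ?_)
        exact (Finset.abs_sum_le_sum_abs _ _).trans (Finset.sum_le_sum fun μ _ => Finset.abs_sum_le_sum_abs _ _)
    _ ≤ 6 * ∑ κ : Fin d, ∑ μ : Fin d, ∑ ν : Fin d, a * (S μ ν + S ν κ) := by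
        refine mul_le_mul_of_nonneg_left ?_ (by norm_num)
        exact Finset.sum_le_sum fun κ _ => Finset.sum_le_sum fun μ _ => Finset.sum_le_sum fun ν _ => hRle κ μ ν
    _ = 12 * d * a * ∑ x ∈ periodBox (d := d) P, ∑ μ : Fin d, ∑ ν : Fin d, ‖B x μ ν‖ ^ 2 := by
        rw [hcount, hNB]; ring

/-- **THE ONE-SIDED CONSUMER FORM**: `G₂ ≤ C₂∕3 + 2·Div₂ + 4·d·a·‖B‖²` — the gradient energy of an antisymmetric periodic 2-form is controlled by
the energies of its covariant exterior derivative and of its covariant codifferential, up to an `O(a)` multiple of its own `ℓ²` norm. [folklore] -/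
theorem grad_le_ext_add_div [Nonempty n] {a : ℝ} (hP : 1 ≤ P) (hV : IsUnitaryCfg V) (hVP : IsPeriodicCfg V (P : ℤ))
    (hplaq : ∀ (z : Site d) (μ ν : Fin d), ‖((hol V z (plaqWord μ ν) : (Matrix n n ℂ)ˣ) : (Matrix n n ℂ)) - 1‖ ≤ a)
    (hB : ∀ (x : Site d) (κ μ ν : Fin d), B (x + (P : ℤ) • e κ) μ ν = B x μ ν)
    (hanti : ∀ (x : Site d) (μ ν : Fin d), B x ν μ = -B x μ ν) :
    (∑ x ∈ periodBox (d := d) P, ∑ κ : Fin d, ∑ μ : Fin d, ∑ ν : Fin d, nhsNormSq (cD V κ (fun y => B y μ ν) x))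
      ≤ (∑ x ∈ periodBox (d := d) P, ∑ κ : Fin d, ∑ μ : Fin d, ∑ ν : Fin d,
            nhsNormSq (cD V κ (fun y => B y μ ν) x + cD V μ (fun y => B y ν κ) x + cD V ν (fun y => B y κ μ) x)) / 3
        + 2 * (∑ x ∈ periodBox (d := d) P, ∑ ν : Fin d, nhsNormSq (∑ μ : Fin d, cDstar V μ (fun y => B y μ ν) x))
        + 4 * d * a * ∑ x ∈ periodBox (d := d) P, ∑ μ : Fin d, ∑ ν : Fin d, ‖B x μ ν‖ ^ 2 := by
  have h := covariant_weitzenbock_twoForm hP hV hVP hplaq hB hanti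
  rw [abs_le] at h
  obtain ⟨-, h2⟩ := h
  linarith

end Periodic

end

end Summit.QuantumFields.BalabanUV.T4Continuum.NE7CovariantWeitzenbockTwoForm
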